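import Literature.AlgebraicGeometry.Motives.CartierDivisorLineBundleSectionsOn
import Literature.AlgebraicGeometry.Motives.AbelianVariety
import Literature.AlgebraicGeometry.Morphisms.FormalFunctionsModuleComplete
import Literature.AlgebraicGeometry.Modules.LineBundleOfCocycleClass
import Literature.AlgebraicGeometry.Morphisms.CohOfVectorBundle
import Literature.Algebra.Homology.HomologyAddEquivTransfer
import HarnessLib

/-!
# `Γ(X, 𝒪_X(D))` is finite-dimensional for a Cartier divisor on a proper integral scheme over a field
# (Görtz–Wedhorn II Thm. 23.17 / Cor. 23.18 for `i = 0`; Serre)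

Layer `Literature/AlgebraicGeometry/Motives`, namespaces `Literature.AlgebraicGeometry.Motives.CartierDivisor` (§1) and
`Literature.AlgebraicGeometry.Motives.AbelianVariety` (§2).  KERNEL ONLY: theorems; no definition, no named fact, no instance, no
`sorry`.  Universe-polymorphic (`K : Type u`, `Y : Scheme.{u}`).

For an integral scheme `Y` proper over a field `K` and ANY Cartier divisor `D` on `Y` (effective or not, ample or not), the
`K`-vector space `Γ(Y, 𝒪_Y(D)) = {s ∈ K(Y) ; (s) + D ≥ 0}` (★ `CartierDivisor.sections`) is finite-dimensional, so that ★
`CartierDivisor.h0 = dim_K Γ(Y, 𝒪_Y(D))` carries no junk.  ROUTE (all inputs ★): the glued line bundle `Modules.lineBundle D.toUnitCocycle`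
is finite locally free (★ `isFiniteLocallyFree_lineBundle`), hence coherent (★ `Morphisms.coh_of_isVectorBundle`); its global sections
are a finitely generated `K`-module by the finiteness of coherent cohomology on proper schemes (★
`Morphisms.moduleFinite_msections_of_coh`, [GortzWedhorn2023] Thm. 23.17 for `i = 0`); and the canonical additive bijection
`Γ(Y, lineBundle 𝒪_Y(D)) ≃ Γ(Y, 𝒪_Y(D))` (★ `CartierDivisor.lineBundleSectionsOnEquiv`, [GortzWedhorn2020] (11.9)) is `K`-linear
(the device of ★ `CartierDivisor.finrank_secMod_lineBundle_eq_h0`), so finiteness transports (★ `Module.Finite.of_addEquiv_semilinear`).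

* §1 `CartierDivisor.finiteDimensional_sections` (any `D`), `finiteDimensional_sections_smul` (`n • D`).
* §2 `AbelianVariety.finiteDimensional_sections` / `_smul` — on an abelian variety over `k` (proper by definition).

Consumer (cell `hodgecm-mathlib`, D-0151, road G5 for the named fact VI-7 ★ `Jacobian.riemann_brillNoetherLocus_isPrincipalPolarizationDivisor`):
the linear-system half (V7-c-i) of Mumford §6 Application 1 «effective `D` with finite `K(D)` is ample» needs a BASIS of `Γ(A, 𝒪_A(2D))`
(the complete linear system `|2D|`).  COUNT-NEUTRAL.  HC_CM is proved only modulo the 7 printed citations until rung 0 closes.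

## References
* [GortzWedhorn2023] U. Görtz, T. Wedhorn, *Algebraic Geometry II: Cohomology of Schemes* (2023), Thm. 23.17 and Cor. 23.18 (pp. 306–307).
* [GortzWedhorn2020] U. Görtz, T. Wedhorn, *Algebraic Geometry I: Schemes*, 2nd ed. (2020), Section (11.9) (p. 301), Rem. 11.16 (p. 298).
* [MumfordAV1970] D. Mumford, *Abelian Varieties* (1970), §6 Application 1 (pp. 60–61).
-/

set_option autoImplicit false

noncomputable section

universe u

open CategoryTheory AlgebraicGeometry TopologicalSpace Opposite

namespace Literature.AlgebraicGeometry.Motives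

namespace CartierDivisor

open Literature.AlgebraicGeometry.Modules Literature.AlgebraicGeometry.Morphisms RatFn

/-! ## §1 Proper integral schemes over a field -/

section Proper

variable {K : Type u} [Field K] (Y : Over (Spec (.of K))) [IsIntegral Y.left] [IsProper Y.hom] (D : CartierDivisor Y.left)

/-- **`Γ(Y, 𝒪_Y(D))` is finite-dimensional** for every Cartier divisor `D` on an integral scheme `Y` proper over a field `K`
(finiteness of `H⁰` of the coherent line bundle `𝒪_Y(D)`, transported to the rational-function model of ★ `CartierDivisor.sections`
along the `K`-linear bijection ★ `lineBundleSectionsOnEquiv`). [cite: GortzWedhorn2023, Thm. 23.17 and Cor. 23.18 (pp. 306–307)]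
[cite: GortzWedhorn2020, Section (11.9) (p. 301) and Rem. 11.16 (p. 298)] -/
theorem finiteDimensional_sections : FiniteDimensional K (D.sections K) := by
  classical
  -- `𝒪_Y(D)` glued is finite locally free, hence coherent, hence `Γ` is finite over `K` (GW II 23.17, `i = 0`)
  have hE : Coh (Modules.lineBundle D.toUnitCocycle) :=
    coh_of_isVectorBundle D.toUnitCocycle.isFiniteLocallyFree_lineBundle.isVectorBundle
  haveI : Module.Finite K (MSections Y.hom (Modules.lineBundle D.toUnitCocycle) ⊤) :=
    moduleFinite_msections_of_coh Y.hom hE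
  -- the additive bijection with the rational-function sections
  have hW : genericPoint Y.left ∈ (⊤ : Y.left.Opens) := trivial
  have hρ : ∀ a, ∀ x ∈ (⊤ : Y.left.Opens), IsRegularAt x (algebraMap K Y.left.functionField a) :=
    fun a x _ => RatFn.isRegularAt_algebraMap x a
  have hsec : ∀ s : Y.left.functionField, D.IsSectionOn (⊤ : Y.left.Opens) s ↔ D.IsSection s :=
    fun s => ⟨fun h i x hx => h i x hx trivial, fun h i x hx _ => h i x hx⟩
  let e := D.lineBundleSectionsOnEquiv hW hρ
  let j : MSections Y.hom (Modules.lineBundle D.toUnitCocycle) ⊤ ≃+ D.sections K :=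
    e.trans ⟨⟨fun s => ⟨s.1, (hsec s.1).1 s.2⟩, fun s => ⟨s.1, (hsec s.1).2 s.2⟩, fun _ => rfl, fun _ => rfl⟩, fun _ _ => rfl⟩
  -- `K`-linearity of `j`: the scalar `a` acts on `Γ(lineBundle, ⊤)` through `ρ(a) = a·1 ∈ Γ(Y, 𝒪_Y)`, whose rational function is `a`
  have ht : ∀ a : K, (algebraMap K (Sections Y.hom ⊤) a : Γ(Y.left, ⊤)) = algebraMapΓ Y.hom a := fun a => by
    rw [Sections.algebraMap_apply]
    rw [show (homOfLE (le_top : (⊤ : Y.left.Opens) ≤ ⊤)) = 𝟙 _ from Subsingleton.elim _ _, op_id, Y.left.presheaf.map_id]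
    rfl
  have hσ : ∀ a : K, ofSection hW (algebraMapΓ Y.hom a) = algebraMap K Y.left.functionField a := fun a => by
    rw [IsScalarTower.algebraMap_apply K (Y.left.presheaf.stalk (genericPoint Y.left)) Y.left.functionField a,
      RatFn.algebraMap_stalk_apply]
    rfl
  have hj : ∀ (a : K) (m : MSections Y.hom (Modules.lineBundle D.toUnitCocycle) ⊤), j (a • m) = a • j m := fun a m => by
    apply Subtype.ext
    change (e (a • m) : Y.left.functionField) = a • (e m : Y.left.functionField)
    have hm : (a • m : MSections Y.hom (Modules.lineBundle D.toUnitCocycle) ⊤) =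
        (show Γ(Modules.lineBundle D.toUnitCocycle, ⊤) from (algebraMapΓ Y.hom a) • (show Γ(Modules.lineBundle D.toUnitCocycle, ⊤) from m)) := by
      rw [← MSections.algebraMap_smul, ht]
      rfl
    rw [hm, D.coe_lineBundleSectionsOnEquiv_smul hW hρ, hσ, Algebra.smul_def]
  refine Module.Finite.of_addEquiv_semilinear (RingHom.id K) Function.surjective_id j.symm (fun c x => ?_)
  apply j.injective
  rw [AddEquiv.apply_symm_apply, RingHom.id_apply, hj, AddEquiv.apply_symm_apply]

/-- `Γ(Y, 𝒪_Y(n • D))` is finite-dimensional (the complete linear system `|nD|` is a finite projective space).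
[cite: GortzWedhorn2023, Thm. 23.17 and Cor. 23.18 (pp. 306–307)] -/
theorem finiteDimensional_sections_smul (n : ℕ) : FiniteDimensional K ((n • D).sections K) :=
  finiteDimensional_sections Y (n • D)

end Proper

end CartierDivisor

/-! ## §2 Abelian varieties -/

namespace AbelianVariety

variable {k : Type u} [Field k] (A : AbelianVariety k) (D : CartierDivisor A.X.left)

/-- **`Γ(A, 𝒪_A(D))` is finite-dimensional** for every Cartier divisor on an abelian variety (proper over `k`).
[cite: GortzWedhorn2023, Thm. 23.17 and Cor. 23.18 (pp. 306–307)] [cite: MumfordAV1970, §6 Application 1 (pp. 60–61)] -/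
theorem finiteDimensional_sections : FiniteDimensional k (D.sections k) :=
  CartierDivisor.finiteDimensional_sections A.X D

/-- `Γ(A, 𝒪_A(n • D))` is finite-dimensional — for `n = 2` the complete linear system `|2D|` of Mumford §6 Application 1.
[cite: MumfordAV1970, §6 Application 1 (pp. 60–61)] [cite: GortzWedhorn2023, Thm. 23.17 and Cor. 23.18 (pp. 306–307)] -/
theorem finiteDimensional_sections_smul (n : ℕ) : FiniteDimensional k ((n • D).sections k) :=
  CartierDivisor.finiteDimensional_sections A.X (n • D)

end AbelianVariety

end Literature.AlgebraicGeometry.Motives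

end
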